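import Literature.MathematicalPhysics.QuantumFieldTheory.Balaban1983to89.B9Thm313WholeDir
import Literature.MathematicalPhysics.QuantumFieldTheory.Balaban1983to89.B9Thm313WholeHolder
import Literature.MathematicalPhysics.QuantumFieldTheory.Balaban1983to89.B9Thm312WholeLeftStepFrom3131

/-!
# `Balaban1983to89.B9Thm312WholeStepDirFrom3131` — [B9] Theorem 3.12 (pp. 421–423): THE LEFT-FORM MEMBERS OF THE DIRECTION-INDEXED
# PERTURBATION-STEP SCHEMA (`B9Thm312WholeDir.StepDir`: ∇_{U,ν}G₀T, Φ^Y_β∇_UG₀T, Φ^X_β∇_{U,ν}G₀T, Φ^X_βG₀T for T = Δ′_π, Δ′_π + Δ⁽²⁾_π)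
# PROVED from Theorem 3.3 for G₀ and the printed letters (3.131) ∕ (3.137) — the gauge-mode derivative moved to the left (p. 421),
# one composition ([4] (2.54) + (2.61)) and one scale transfer (p. 398 ∕ [4] (2.60)) per member

T. Bałaban, *Propagators for lattice gauge theories in a background field*, Commun. Math. Phys. **99** (1985) 389–434
[`Balaban1985BackgroundPropagators`, "B9"]; [4] = T. Bałaban, *Propagators and renormalization transformations for lattice gauge
theories. II*, Commun. Math. Phys. **96** (1984) 223–250 [`Balaban1984PropagatorsII`].

statement-level skeleton of published theorems with citation tags; proofs where landed; nothing here is a claim about the Yang–Mills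
mass gap

THE PRINTED LOCUS (held text `paper:balaban1985-cmp99-background-propagators`).  p. 421: *"One of the three derivatives there has to be
applied either to an expression on the right, or on the left, of Δ′_π"*; p. 422: *"This inequality [(3.131)] and Theorem 3.3 for G₀ imply a
convergence of the series (3.130), for α₀ sufficiently small, in all norms appearing on the left-hand sides of the inequalities (3.42)–(3.47)"*;
p. 423: *"we have derivatives in the operator Δ′_π + Δ⁽²⁾_π which have to be applied either to the operator on the right, or on the left … This
estimate is given for first factors in a term, the remaining factors are easier to estimate, following the above pattern"*; (3.39)–(3.40)
p. 397 (the norms run over all directions; the Hölder quotients); (3.42)–(3.45) pp. 397–398; p. 398: *"we may always replace ∇_U by ∇\*_U,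
and vice versa, in arbitrary place and combination … we may replace the factor (Lʲη)^α by (Lʲη)^β(L^{j′}η)^γ with β + γ = α"*.

THE POINT.  After `B9Thm312WholeStepFrom3131` (the sup-class `Step`) and `B9Thm312WholeLeftStepFrom3131` (`LeftStep.stepD`), the Sect.-D
leaves of rows 20–21 still display the direction-indexed step schema `StepDir 𝔬 𝔭 Dd Dds R₀ H₀ bHX hlen θD θH δK U` (n06-d's binder
`hstepC`, conjunct 1): ten field families, eight of them in the LEFT form E∘G₀∘T with T ∈ {Δ′_π, Δ′_π + Δ⁽²⁾_π} — `sDd ∕ sDd1` (E = ∇_{U,ν}),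
`pY ∕ pY1` (E = Φ^Y_β∇_U), `pXd ∕ pXd1` (E = Φ^X_β∇_{U,ν}), `pX ∕ pX1` (E = Φ^X_β) — and two in the RIGHT form T∘G₀∘∇\*_{U,μ} (`tDd ∕ tDd1`).
With the letters `Letters3131` (Δ′_π = T_a + D·T_b, Δ⁽²⁾_π = T_a₂ + D·T_b₂, D = the gauge-mode derivative moved left) every LEFT-form member is
E∘G₀∘T_a + (E∘G₀∘D)∘T_b: the first summand is Theorem 3.3's member E∘G₀ for G₀ composed with T_a, the second the mixed member E∘G₀D (read
from the scalar Hölder class `bH`) composed with T_b — ONE composition each ([4] (2.54) + Lemma 2.1 (2.61) at the margin σ), plus for E = Φ^X_β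
ONE scale transfer (source 𝔠⁽¹⁾ rather than 𝔠⁽²⁾, p. 398).  THIS FILE types that:
* §1 `Thm33G0DirX 𝔬 𝔭 Dd R₀ H₀ hlen bH Bx0 BdX δ₀ δ₃ U` — TWO Theorem-3.3-TYPE X-PROBE MEMBERS OF G₀ the left form reads and the sibling schemas
  (`Thm33G0Dir`, `Letters313H`, `Letters313DM`) do not carry: `pX0 β` — the ZEROTH-ORDER Hölder probe Φ^X_β∘G₀ : 𝔠⁽⁰⁾ → 𝔠_P^{(β−2)}
  (‖ζG₀B‖_β ≦ B(β)(Lʲη)^{2−β}e^{−δ₀d}|B|: the β-interpolate of (3.42)₁,₂ through (3.40)), and `pXdDH ν β` — the probe Φ^X_β∘∇_{U,ν}G₀D out of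
  `bH` into 𝔠_P^{(β−1)} (the direction twin of `Letters313H.pYDH`; a (3.45)-type member with the gauge-mode derivative, [4] (2.26)).  A
  HYPOTHESIS SCHEMA of printed type; nothing asserted.
* §2 `hasMaj_probe_cNormR_of_hom` (a (3.43)-shape two-space majorant IS a majorant 𝔠⁽⁰⁾ → 𝔠_P^{(β−1)}), `hasMaj_transfer_one` (p. 398's transfer
  by ONE power of the scale: 𝔠_V^{(t)} → 𝔠^{(s)} with C·e^{−rd} ⇒ 𝔠_V^{(t+1)} → 𝔠^{(s+1)} with C·L₀·e^{−(r−αδ)d}, from the member facts `Facts347`).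
* §3 ★ `probeStep_of_split` (GENERIC left probe member E∘G₀∘T from 𝔠^{(−2)}: (a + κ_H·a_D)·t·c·e^{−ρd}), ★ `probeStepX_of_split` (the Φ^X_β∘G₀∘T member
  from 𝔠^{(−1)}: (a + a_D)·t·c·L₀·e^{−(ρ−αδ)d}), ★ `stepDd_of_letters3131` (the `sDd ∕ sDd1` fields for every ν, constant 2(B₀ + κ_H·B₃)·t·c).
* §4 ★★ `stepDir_of_letters3131` — `StepDir 𝔬 𝔭 Dd Dds R₀ H₀ bHX hlen θD θH δK U` from `Thm33G0Dir` (h43L, e1d, h43d; rows 18's after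
  `B9Thm312WholeFromThm310.thm33G0Dir_of_conv3107`), `Letters313H` (pYDH, pXDv), `Letters313DM` (dgDHd), `Thm33G0DirX`, `Letters3131`,
  `Letters3131H`, the row sum and `Facts347`, the two RIGHT-form families `tDd ∕ tDd1` AS HYPOTHESES (displayed: a right split of T is
  another letter schema, not typed here), for θ_D ≧ 2(B₀ + κ_H·B₃)tc, δ_K + αδ ≦ ρ and θ_H dominating the three β-families of constants
  2(B_h(β) + κ_H·B_hD(β))tc, 2(B_h(β) + κ_H·B_dX(β))tc, 2(B_x0(β) + B_x(β))tcL₀ FOR ALL β ∈ [0,1).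

LOCATED REMARK U2 (design, not a claim).  `StepDir` (like `StepH`) carries ONE constant θ_H for all Hölder exponents β ∈ [0,1), whereas print's
Hölder constants B₀(β), B′₀(ε,β) *"→ ∞ if β → 1"* (Theorem 3.1 p. 397–398).  The β-dependent content is §3 (constants as functions of β); the
assembly §4 therefore displays the β-UNIFORM domination hypotheses `hθH1–hθH3`, satisfiable at the instance only through β-uniform bounds on
rows 18's Hölder letter constants — an artefact of the registered schema's shape, recorded for the planner (a β-indexed θ_H : ℝ → ℝ in
`StepDir` would remove it; that is a reshape of the PairM leaves, not done here).  The same holds in ε for the right-form families `tDd ∕ tDd1`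
(one θ_H for every input exponent ε > 0, while print's B′₀(ε) → ∞ as ε → 0: LOCATED REMARK U3), which is one reason they stay hypotheses here.
LOCATED REMARK U1 of the sibling files stands (raw sup-class inputs vs print's sandwiched right form).

HONEST SCOPE.  Kernel-checked bookkeeping: eight displayed operator-product families of rows 20–21 become theorems of displayed letters about
Δ′_π, Δ⁽²⁾_π alone (`Letters3131`, `Letters3131H` — printed shape, the located gap G-B9-16) plus Theorem-3.3-type members of G₀ (two of them new
displayed letters, §1) and the two right-form families.  COUNT-NEUTRAL; N06 is NOT discharged; one finite lattice at a time; nothing continuum,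
nothing about the mass gap.  Cell `pub-ymgap` (HUMAN RULING D-0062), Track A node N06 [B9], N06-ASSIGNMENT v1 rows 20–21 (bundle F7), seat
`pub-ymgap-dag-n06-l` (g12), 2026-08-27.
-/

namespace Literature.MathematicalPhysics.QuantumFieldTheory.Balaban1983to89.B9Thm312WholeStepDirFrom3131

open Literature.MathematicalPhysics.QuantumFieldTheory.Balaban1983to89
open Finset B6RandomWalk B6RandomWalkHom B9Thm34Ext B11SectG B9SectDSup B9Thm312Whole B9Thm312WholeLeaf B9Thm312WholeClasses
open B9RWSums343Holder B9RWSums343to347Whole B9RWSums346Schur B9Thm312WholeDir B9Thm313WholeHolder B9Thm313WholeDir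
open B9Thm312WholeStepFrom3131 B9Thm312WholeLeftStepFrom3131

noncomputable section

variable {g : B9.Geometry} {B : B9.Backgrounds} {X Y Z W PX PY P : Type}
variable [Fintype X] [Fintype Y] [Fintype Z] [Fintype W] [Fintype PX] [Fintype PY] [Fintype P] [Fintype g.Site]
variable {R₀ : ℝ} {H₀ : Prop}

/-! ## §1 Two Theorem-3.3-type X-probe members of G₀ (printed type; nothing asserted) -/

/-- **TWO THEOREM-3.3-TYPE X-PROBE MEMBERS OF G₀ READ BY THE LEFT FORM** (block-norm letters over n06-k's probes `𝔭` and the scalar Hölder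
class `bH`; nothing constructed or asserted): `pX0 β` — the zeroth-order Hölder probe of G₀ itself, Φ^X_β∘G₀ from the sharp blocks 𝔠⁽⁰⁾ into
the probe class of weight (Lʲη)^{β−2}, i.e. ‖ζG₀B‖_β ≦ B_x0(β)(Lʲη)^{2−β}e^{−δ₀d(y,y′)}|B| for supp B ⊂ Δ(y′) (the β-interpolate of (3.42)₁ and
(3.42)₂ through the quotients (3.40) with |∇ζ| = O((Lʲη)⁻¹); print displays the pattern for a *"first factor"* G₀Δ⁽²⁾_π… on p. 423);
`pXdDH ν β` — the probe of the mixed member with the gauge-mode derivative, Φ^X_β∘∇_{U,ν}∘G₀∘D out of `bH` into the probe class of weight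
(Lʲη)^{β−1} (the direction twin of `Letters313H.pYDH`; (3.45)-type, D = the derivative of DRD\*, [4] (2.26); *"we may always replace ∇_U by
∇\*_U, and vice versa, in arbitrary place and combination"*, p. 398).  A HYPOTHESIS SCHEMA: at the instance these are Theorem 3.3 ∕ 3.10
statements about G₀ = G(U).
[cite: Balaban1985BackgroundPropagators, Thm 3.3 p.399 + (3.42)–(3.45) pp.397–398 + (3.39)–(3.40) p.397 + p.398 (remarks after (3.47)) + p.423; Balaban1984PropagatorsII, (2.26) p.228] -/
structure Thm33G0DirX (𝔬 : Ops g B X Y Z W) (𝔭 : HolderProbes g B X Y PX PY) (Dd : B.Cfg → P → Module.End ℝ (X → ℝ))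
    (R₀ : ℝ) (H₀ : Prop) (hlen : ∀ y : g.Site, 0 ≤ g.len y) (bH : BlockNorm (toB6 g R₀ H₀) (W → ℝ)) (Bx0 BdX : ℝ → ℝ)
    (δ₀ δ₃ : ℝ) (U : B.Cfg) : Prop where
  pX0 : ∀ β : ℝ, 0 ≤ β → β < 1 → HasMaj (cNormR R₀ H₀ 𝔬.blk hlen 0) (cNormR R₀ H₀ 𝔭.blkPX hlen (β - 2))
    (𝔭.ΦX U β ∘ₗ 𝔬.G0 U) (fun a b => Bx0 β * Real.exp (-(δ₀ * g.dist a b)))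
  pXdDH : ∀ (ν : P) (β : ℝ), 0 ≤ β → β < 1 → HasMaj bH (cNormR R₀ H₀ 𝔭.blkPX hlen (β - 1))
    ((𝔭.ΦX U β ∘ₗ Dd U ν ∘ₗ 𝔬.G0 U) ∘ₗ 𝔬.Dv U) (fun a b => BdX β * Real.exp (-(δ₃ * g.dist a b)))

/-! ## §2 Conversions: a (3.43)-shape majorant as a class majorant; the scale transfer by one power -/

omit [Fintype Y] [Fintype Z] [Fintype W] [Fintype PX] [Fintype PY] [Fintype P] [Fintype X] [Fintype g.Site] in
/-- Kernel monotonicity: C·e^{−rd} ≦ θ·e^{−δ_K d} for 0 ≦ C ≦ θ, δ_K ≦ r, d ≧ 0. [folklore] -/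
private theorem kernel_le'' {C θ r δK d : ℝ} (hC : 0 ≤ C) (hCθ : C ≤ θ) (hδK : δK ≤ r) (hd : 0 ≤ d) :
    C * Real.exp (-(r * d)) ≤ θ * Real.exp (-(δK * d)) :=
  calc C * Real.exp (-(r * d)) ≤ C * Real.exp (-(δK * d)) :=
      mul_le_mul_of_nonneg_left (Real.exp_le_exp.mpr (neg_le_neg (mul_le_mul_of_nonneg_right hδK hd))) hC
    _ ≤ θ * Real.exp (-(δK * d)) := mul_le_mul_of_nonneg_right hCθ (Real.exp_nonneg _)

omit [Fintype Y] [Fintype Z] [Fintype W] [Fintype PY] [Fintype P] in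
/-- **A (3.43)-SHAPE TWO-SPACE MAJORANT AS A MAJORANT OF STATE CLASSES**: |(Tλ)(p)| ≦ B(Lʲη)^{1−β}e^{−δ₀d(y,y′)}|λ| (p over y, supp λ ⊂ Δ(y′)) is the
majorant B·e^{−δ₀d} of T from 𝔠⁽⁰⁾ into the probe class 𝔠_P^{(β−1)} (the power moved into the target size; `hasMaj_cNormR_of_hasMajorantHom`).
[cite: Balaban1985BackgroundPropagators, (3.43) p.398 + p.398 (remark after (3.47)); Balaban1984PropagatorsII, (2.51) p.232] -/
theorem hasMaj_probe_cNormR_of_hom (hG : GeoOK g) {blk : X → g.Site} {blkP : PX → g.Site} {T : (X → ℝ) →ₗ[ℝ] (PX → ℝ)}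
    {Bh β δ₀ : ℝ} (hBh : 0 ≤ Bh)
    (h : HasMajorantHom (g := toB6 g R₀ H₀) blk blkP T
      (fun (a b : g.Site) => Bh * g.len a ^ (1 - β) * Real.exp (-(δ₀ * g.dist a b)))) :
    HasMaj (cNormR R₀ H₀ blk hG.lenle 0) (cNormR R₀ H₀ blkP hG.lenle (β - 1)) T
      (fun a b => Bh * Real.exp (-(δ₀ * g.dist a b))) := by
  have h' := hasMaj_cNormR_of_hasMajorantHom hG (C := fun a b => Bh * Real.exp (-(δ₀ * g.dist a b)))
    (fun a b => mul_nonneg hBh (Real.exp_nonneg _)) (1 - β) 0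
    (hasMajorantHom_mono (g := toB6 g R₀ H₀) blk blkP h fun a b =>
      le_of_eq (by simp only [Real.rpow_zero, mul_one]; ring))
  have e : -(1 - β) = β - 1 := by ring
  rw [e] at h'
  exact h'

omit [Fintype Y] [Fintype Z] [Fintype W] [Fintype PY] [Fintype P] in
/-- **p. 398's SCALE TRANSFER BY ONE POWER OF THE SCALE** (*"we may replace the factor (Lʲη)^α by (Lʲη)^β(L^{j′}η)^γ with β + γ = α"*): a
majorant C·e^{−rd} of T from 𝔠_V^{(t)} into 𝔠^{(s)} is the majorant C·L₀·e^{−(r−αδ)d} from 𝔠_V^{(t+1)} into 𝔠^{(s+1)} — the ratio Lʲη ∕ L^{j′}η costs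
L₀·e^{αδd(y,y′)} by [4] (2.60) in the form of n06-k's member facts `Facts347` (`scaleTransfer_len_rpow` at γ = 1; d symmetric).
[cite: Balaban1985BackgroundPropagators, p.398 (remark after (3.47)); Balaban1984PropagatorsII, Lemma 2.1 (2.60) p.234] -/
theorem hasMaj_transfer_one (hG : GeoOK g) {d : ℕ} {δ α L₀ : ℝ} (hF : Facts347 g R₀ H₀ d δ α L₀)
    {V : Type} [Fintype V] {blkV : V → g.Site} {blk : PX → g.Site} {T : (V → ℝ) →ₗ[ℝ] (PX → ℝ)} {C r s t : ℝ} (hC : 0 ≤ C)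
    (h : HasMaj (cNormR R₀ H₀ blkV hG.lenle t) (cNormR R₀ H₀ blk hG.lenle s) T
      (fun a b => C * Real.exp (-(r * g.dist a b)))) :
    HasMaj (cNormR R₀ H₀ blkV hG.lenle (t + 1)) (cNormR R₀ H₀ blk hG.lenle (s + 1)) T
      (fun a b => C * L₀ * Real.exp (-((r - α * δ) * g.dist a b))) := by
  intro y' μ hμ y
  have hb := h y' μ hμ y
  rw [cNormR_loc, cNormR_loc] at hb
  rw [cNormR_loc, cNormR_loc, Real.rpow_add (hG.lenpos y), Real.rpow_add (hG.lenpos y'), Real.rpow_one, Real.rpow_one]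
  set N := (BlockNorm.ofBlocks (toB6 g R₀ H₀) blk).loc y (T μ) with hN
  set N' := (BlockNorm.ofBlocks (toB6 g R₀ H₀) blkV).loc y' μ with hN'
  have hN0 : 0 ≤ N := (BlockNorm.ofBlocks (toB6 g R₀ H₀) blk).loc_nonneg y (T μ)
  have hN'0 : 0 ≤ N' := (BlockNorm.ofBlocks (toB6 g R₀ H₀) blkV).loc_nonneg y' μ
  have hy : 0 < g.len y := hG.lenpos y
  have hy' : 0 < g.len y' := hG.lenpos y'
  have hs0 : 0 ≤ g.len y ^ s := Real.rpow_nonneg hy.le s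
  have ht0 : 0 ≤ g.len y' ^ t := Real.rpow_nonneg hy'.le t
  -- the transfer at γ = 1: e^{−rd(y,y′)}·Lʲη ≦ L₀·e^{−(r−αδ)d(y,y′)}·L^{j′}η
  have hkey : Real.exp (-(r * g.dist y y')) * g.len y ≤
      L₀ * Real.exp (-((r - α * δ) * g.dist y y')) * g.len y' := by
    have hst := scaleTransfer_len_rpow hF 1 (by norm_num) y' y
    simp only [abs_one, Real.rpow_one] at hst
    rw [hG.symm y' y] at hst
    have h2 : Real.exp (-(α * δ * g.dist y y')) * g.len y ≤ L₀ * g.len y' :=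
      hst.trans (mul_le_mul_of_nonneg_right hF.L_le hy'.le)
    have hsplit : Real.exp (-(r * g.dist y y')) =
        Real.exp (-((r - α * δ) * g.dist y y')) * Real.exp (-(α * δ * g.dist y y')) := by
      rw [← Real.exp_add]; congr 1; ring
    rw [hsplit, mul_assoc]
    calc Real.exp (-((r - α * δ) * g.dist y y')) * (Real.exp (-(α * δ * g.dist y y')) * g.len y)
        ≤ Real.exp (-((r - α * δ) * g.dist y y')) * (L₀ * g.len y') := mul_le_mul_of_nonneg_left h2 (Real.exp_nonneg _)
      _ = L₀ * Real.exp (-((r - α * δ) * g.dist y y')) * g.len y' := by ring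
  have hfac : 0 ≤ C * (g.len y' ^ t * N') := mul_nonneg hC (mul_nonneg ht0 hN'0)
  calc g.len y ^ s * g.len y * N = g.len y * (g.len y ^ s * N) := by ring
    _ ≤ g.len y * (C * Real.exp (-(r * g.dist y y')) * (g.len y' ^ t * N')) := mul_le_mul_of_nonneg_left hb hy.le
    _ = (Real.exp (-(r * g.dist y y')) * g.len y) * (C * (g.len y' ^ t * N')) := by ring
    _ ≤ (L₀ * Real.exp (-((r - α * δ) * g.dist y y')) * g.len y') * (C * (g.len y' ^ t * N')) :=
        mul_le_mul_of_nonneg_right hkey hfac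
    _ = C * L₀ * Real.exp (-((r - α * δ) * g.dist y y')) * (g.len y' ^ t * g.len y' * N') := by ring

/-! ## §3 The left-form members: one composition (and, for Φ^X_β, one transfer) per member -/

omit [Fintype Y] [Fintype Z] [Fintype W] [Fintype PX] [Fintype PY] [Fintype P] in
/-- ★ **THE GENERIC LEFT PROBE MEMBER E∘G₀∘T FOR A SPLIT PERTURBATION T = T_a + D·T_b, FROM 𝔠^{(−2)}**: if E∘G₀ maps 𝔠⁽⁰⁾ into a target class
`bout` with a·e^{−δ₀d} (Theorem 3.3's member of G₀ under the probe E) and E∘G₀∘D maps the scalar class `bH` (cutting cost κ_H) into `bout`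
with a_D·e^{−δ₃d}, while T_a : 𝔠⁽²⁾ → 𝔠⁽⁰⁾ and T_b : 𝔠⁽²⁾ → bH have the small majorants t·e^{−δ_T d}, then (E∘G₀)∘T = (E∘G₀)T_a + (E∘G₀D)T_b
maps 𝔠^{(−2)} into `bout` with (a + κ_H·a_D)·t·c·e^{−ρd} for every 0 ≦ ρ ≦ δ_T with ρ + σ ≦ min(δ₀, δ₃) — [4] (2.54) and Lemma 2.1 (2.61) at
the margin σ.  E ranges over Φ^Y_β∇_U, Φ^X_β∇_{U,ν} (and ∇_{U,ν}, ∇_U themselves: `hasMaj_DG0_comp_split`).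
[cite: Balaban1985BackgroundPropagators, (3.130)–(3.131) pp.421–422 + (3.137)–(3.138) p.423 + (3.43)–(3.45) p.398; Balaban1984PropagatorsII, (2.52)–(2.56) pp.232–233 + Lemma 2.1 (2.61) p.234] -/
theorem probeStep_of_split (hG : GeoOK g) {F : Type} [AddCommGroup F] [Module ℝ F] {bout : BlockNorm (toB6 g R₀ H₀) F}
    {blk : X → g.Site} {bH : BlockNorm (toB6 g R₀ H₀) (W → ℝ)} {EG : (X → ℝ) →ₗ[ℝ] F}
    {T Ta : Module.End ℝ (X → ℝ)} {Dv : (W → ℝ) →ₗ[ℝ] (X → ℝ)} {Tb : (X → ℝ) →ₗ[ℝ] (W → ℝ)}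
    {a aD t δ₀ δ₃ δT ρ σ c : ℝ} (hrow : RowSum (toB6 g R₀ H₀) σ c)
    (ha : 0 ≤ a) (haD : 0 ≤ aD) (ht : 0 ≤ t) (hρ : 0 ≤ ρ) (hρT : ρ ≤ δT) (hρ₀ : ρ + σ ≤ δ₀) (hρ₃ : ρ + σ ≤ δ₃)
    (hsplit : T = Ta + Dv ∘ₗ Tb)
    (hE : HasMaj (cNormR R₀ H₀ blk hG.lenle 0) bout EG (fun a' b => a * Real.exp (-(δ₀ * g.dist a' b))))
    (hED : HasMaj bH bout (EG ∘ₗ Dv) (fun a' b => aD * Real.exp (-(δ₃ * g.dist a' b))))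
    (hta : HasMaj (cNorm R₀ H₀ blk hG.lenle 2) (cNorm R₀ H₀ blk hG.lenle 0) Ta
      (fun a' b => t * Real.exp (-(δT * g.dist a' b))))
    (htbH : HasMaj (cNorm R₀ H₀ blk hG.lenle 2) bH Tb (fun a' b => t * Real.exp (-(δT * g.dist a' b)))) :
    HasMaj (cNormR R₀ H₀ blk hG.lenle (-2)) bout (EG ∘ₗ T)
      (fun a' b => (a + bH.κ * aD) * t * c * Real.exp (-(ρ * g.dist a' b))) := by
  have htri : Triangle254 (toB6 g R₀ H₀) := fun a b c => hG.tri a b c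
  have hta' : HasMaj (cNormR R₀ H₀ blk hG.lenle (-2)) (cNormR R₀ H₀ blk hG.lenle 0) Ta
      (fun a' b => t * Real.exp (-(δT * g.dist a' b))) := by
    have h := hasMaj_toR hG hta
    simp only [Nat.cast_zero, neg_zero, Nat.cast_ofNat] at h
    exact h
  have htb' : HasMaj (cNormR R₀ H₀ blk hG.lenle (-2)) bH Tb (fun a' b => t * Real.exp (-(δT * g.dist a' b))) := by
    have h := hasMaj_toR_src hG htbH
    simp only [Nat.cast_ofNat] at h
    exact h
  have h1 := hasMaj_comp_exp htri hG.dnn hrow ha ht hρ hρT hρ₀ hE hta'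
  have h2 := hasMaj_comp_exp htri hG.dnn hrow haD ht hρ hρT hρ₃ hED htb'
  refine ((h1.add h2).congr fun μ => ?_).mono fun a' b => le_of_eq ?_
  · rw [hsplit]
    simp only [LinearMap.add_apply, LinearMap.comp_apply, map_add]
  · simp only [cNormR_κ, toB6_dist]
    ring

omit [Fintype Y] [Fintype Z] [Fintype PY] [Fintype P] in
/-- ★ **THE Φ^X_β-PROBE OF THE STEP ITSELF, Φ^X_β∘G₀∘T FROM 𝔠^{(−1)}**: with the zeroth-order probe Φ^X_β∘G₀ : 𝔠⁽⁰⁾ → 𝔠_P^{(β−2)} (a·e^{−δ₀d}), the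
probe of the mixed member (Φ^X_βG₀)∘D : 𝔠_W⁽⁰⁾ → 𝔠_P^{(β−1)} (a_D·e^{−δ₃d}, `Letters313H.pXDv`'s shape), T_a : 𝔠⁽²⁾ → 𝔠⁽⁰⁾ and T_b : 𝔠⁽²⁾ → 𝔠_W⁽¹⁾
(t·e^{−δ_T d}): (Φ^X_βG₀)∘T = [(Φ^X_βG₀)T_a, transferred by one power] + (Φ^X_βG₀D)[T_b transferred by one power] maps 𝔠^{(−1)} into 𝔠_P^{(β−1)}
with (a + a_D)·t·c·L₀·e^{−(ρ−αδ)d} (αδ ≦ ρ ≦ δ_T, ρ + σ ≦ min(δ₀, δ₃); compositions at the margin σ, transfers by `Facts347`).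
[cite: Balaban1985BackgroundPropagators, (3.130)–(3.131) pp.421–422 + (3.138) p.423 + (3.43) p.398 + p.398 (remark after (3.47)); Balaban1984PropagatorsII, (2.54) p.233 + Lemma 2.1 (2.60)–(2.61) p.234] -/
theorem probeStepX_of_split (hG : GeoOK g) {d : ℕ} {δ α L₀ : ℝ} (hF : Facts347 g R₀ H₀ d δ α L₀)
    {blk : X → g.Site} {blkW : W → g.Site} {blkP : PX → g.Site} {EG : (X → ℝ) →ₗ[ℝ] (PX → ℝ)}
    {T Ta : Module.End ℝ (X → ℝ)} {Dv : (W → ℝ) →ₗ[ℝ] (X → ℝ)} {Tb : (X → ℝ) →ₗ[ℝ] (W → ℝ)}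
    {a aD t β δ₀ δ₃ δT ρ σ c : ℝ} (hrow : RowSum (toB6 g R₀ H₀) σ c) (hc : 0 ≤ c)
    (ha : 0 ≤ a) (haD : 0 ≤ aD) (ht : 0 ≤ t) (hαρ : α * δ ≤ ρ) (hαδ : 0 ≤ α * δ) (hρT : ρ ≤ δT) (hρ₀ : ρ + σ ≤ δ₀)
    (hρ₃ : ρ + σ ≤ δ₃) (hsplit : T = Ta + Dv ∘ₗ Tb)
    (hE : HasMaj (cNormR R₀ H₀ blk hG.lenle 0) (cNormR R₀ H₀ blkP hG.lenle (β - 2)) EG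
      (fun a' b => a * Real.exp (-(δ₀ * g.dist a' b))))
    (hEDv : HasMaj (cNormR R₀ H₀ blkW hG.lenle 0) (cNormR R₀ H₀ blkP hG.lenle (β - 1)) (EG ∘ₗ Dv)
      (fun a' b => aD * Real.exp (-(δ₃ * g.dist a' b))))
    (hta : HasMaj (cNorm R₀ H₀ blk hG.lenle 2) (cNorm R₀ H₀ blk hG.lenle 0) Ta
      (fun a' b => t * Real.exp (-(δT * g.dist a' b))))
    (htb : HasMaj (cNorm R₀ H₀ blk hG.lenle 2) (cNorm R₀ H₀ blkW hG.lenle 1) Tb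
      (fun a' b => t * Real.exp (-(δT * g.dist a' b)))) :
    HasMaj (cNormR R₀ H₀ blk hG.lenle (-1)) (cNormR R₀ H₀ blkP hG.lenle (β - 1)) (EG ∘ₗ T)
      (fun a' b => (a + aD) * t * c * L₀ * Real.exp (-((ρ - α * δ) * g.dist a' b))) := by
  have htri : Triangle254 (toB6 g R₀ H₀) := fun a b c => hG.tri a b c
  have hρ : 0 ≤ ρ := hαδ.trans hαρ
  have hρ' : 0 ≤ ρ - α * δ := by linarith
  have hta' : HasMaj (cNormR R₀ H₀ blk hG.lenle (-2)) (cNormR R₀ H₀ blk hG.lenle 0) Ta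
      (fun a' b => t * Real.exp (-(δT * g.dist a' b))) := by
    have h := hasMaj_toR hG hta
    simp only [Nat.cast_zero, neg_zero, Nat.cast_ofNat] at h
    exact h
  have htb' : HasMaj (cNormR R₀ H₀ blk hG.lenle (-2)) (cNormR R₀ H₀ blkW hG.lenle (-1)) Tb
      (fun a' b => t * Real.exp (-(δT * g.dist a' b))) := by
    have h := hasMaj_toR hG htb
    simp only [Nat.cast_one, Nat.cast_ofNat] at h
    exact h
  -- first summand: (Φ G₀) T_a : 𝔠^{(−2)} → 𝔠_P^{(β−2)}, then the transfer by one power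
  have h1 := hasMaj_comp_exp htri hG.dnn hrow ha ht hρ hρT hρ₀ hE hta'
  simp only [cNormR_κ, one_mul] at h1
  have h1' := hasMaj_transfer_one hG hF (mul_nonneg (mul_nonneg ha ht) hc) h1
  have e1 : (-2 : ℝ) + 1 = -1 := by norm_num
  have e2 : β - 2 + 1 = β - 1 := by ring
  rw [e1, e2] at h1'
  -- second summand: T_b transferred by one power : 𝔠^{(−1)} → 𝔠_W⁽⁰⁾, then (Φ G₀ D)
  have htb'' := hasMaj_transfer_one hG hF ht htb'
  have e3 : (-1 : ℝ) + 1 = 0 := by norm_num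
  rw [e1, e3] at htb''
  have hρT' : ρ - α * δ ≤ δT - α * δ := by linarith
  have hρ₃' : ρ - α * δ + σ ≤ δ₃ := by linarith
  have h2 := hasMaj_comp_exp htri hG.dnn hrow haD (mul_nonneg ht (le_trans (le_trans zero_le_one hF.one_le_L) hF.L_le))
    hρ' hρT' hρ₃' hEDv htb''
  simp only [cNormR_κ, one_mul] at h2
  refine ((h1'.add h2).congr fun μ => ?_).mono fun a' b => le_of_eq ?_
  · rw [hsplit]
    simp only [LinearMap.add_apply, LinearMap.comp_apply, map_add]
  · simp only [toB6_dist]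
    ring

omit [Fintype Y] [Fintype Z] [Fintype PX] [Fintype PY] [Fintype P] in
/-- ★ **THE DERIVATIVE OF THE STEP THROUGH EVERY COMPONENT ∇_{U,ν}** — the fields `sDd ν`, `sDd1 ν` of `StepDir`: ∇_{U,ν}G₀Δ′_π and
∇_{U,ν}G₀(Δ′_π + Δ⁽²⁾_π) map 𝔠⁽²⁾ into 𝔠⁽¹⁾ with θ_D·e^{−δ_K d} for every θ_D ≧ 2(B₀ + κ_H·B₃)·t·c and δ_K ≦ ρ — from (3.42)₂ for the component
∇_{U,ν}G₀ (`Thm33G0Dir.e1d`'s shape), the mixed letter ∇_{U,ν}G₀D out of `bH` (`Letters313DM.dgDHd`'s shape), `Letters3131` and `Letters3131H`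
(verbatim the computation of `B9Thm312WholeLeftStepFrom3131.stepD_of_letters3131` with ∇_U ↦ ∇_{U,ν}).
[cite: Balaban1985BackgroundPropagators, Thm 3.12 p.423 + (3.130)–(3.131) pp.421–422 + (3.137)–(3.138) p.423 + (3.42)–(3.44) pp.397–398 + (3.39) p.397; Balaban1984PropagatorsII, (2.54) p.233 + Lemma 2.1 (2.61) p.234] -/
theorem stepDd_of_letters3131 (hG : GeoOK g) {𝔬 : Ops g B X Y Z W} {Dd : B.Cfg → P → Module.End ℝ (X → ℝ)}
    {Ta Ta₂ : B.Cfg → Module.End ℝ (X → ℝ)} {Tb Tb₂ : B.Cfg → (X → ℝ) →ₗ[ℝ] (W → ℝ)}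
    {bH : BlockNorm (toB6 g R₀ H₀) (W → ℝ)} {U : B.Cfg} {B₀ B₃ t δ₀ δ₃ δT ρ σ c θD δK : ℝ}
    (hrow : RowSum (toB6 g R₀ H₀) σ c) (hc : 0 ≤ c) (hB₀ : 0 ≤ B₀) (hB₃ : 0 ≤ B₃) (ht : 0 ≤ t) (hρ : 0 ≤ ρ) (hρT : ρ ≤ δT)
    (hρ₀ : ρ + σ ≤ δ₀) (hρ₃ : ρ + σ ≤ δ₃) (hθD : 2 * ((B₀ + bH.κ * B₃) * t * c) ≤ θD) (hδK : δK ≤ ρ)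
    (he1d : ∀ ν : P, HasMajorantHom (g := toB6 g R₀ H₀) 𝔬.blk 𝔬.blk (Dd U ν ∘ₗ 𝔬.G0 U)
      (fun (a b : g.Site) => B₀ * g.len a * Real.exp (-(δ₀ * g.dist a b))))
    (hdgDHd : ∀ ν : P, HasMaj bH (cNorm R₀ H₀ 𝔬.blk hG.lenle 1) (Dd U ν ∘ₗ 𝔬.G0 U ∘ₗ 𝔬.Dv U)
      (fun a b => B₃ * Real.exp (-(δ₃ * g.dist a b))))
    (hL : Letters3131 𝔬 Ta Ta₂ Tb Tb₂ R₀ H₀ hG.lenle t δT U) (hLH : Letters3131H 𝔬 Tb Tb₂ R₀ H₀ hG.lenle bH t δT U) (ν : P) :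
    HasMaj (cNorm R₀ H₀ 𝔬.blk hG.lenle 2) (cNorm R₀ H₀ 𝔬.blk hG.lenle 1) (Dd U ν ∘ₗ 𝔬.G0 U ∘ₗ 𝔬.Tpi U)
        (fun a b => θD * Real.exp (-(δK * g.dist a b))) ∧
      HasMaj (cNorm R₀ H₀ 𝔬.blk hG.lenle 2) (cNorm R₀ H₀ 𝔬.blk hG.lenle 1) (Dd U ν ∘ₗ 𝔬.G0 U ∘ₗ (𝔬.Tpi U + 𝔬.T2 U))
        (fun a b => θD * Real.exp (-(δK * g.dist a b))) := by
  have hD0 := hasMaj_DG0_cNorm (R₀ := R₀) (H₀ := H₀) hG hB₀ (he1d ν)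
  have hA := hasMaj_DG0_comp_split hG hrow hB₀ hB₃ ht hρ hρT hρ₀ hρ₃ hL.split hD0 (hdgDHd ν) hL.ta hLH.tbH
  have hB := hasMaj_DG0_comp_split hG hrow hB₀ hB₃ ht hρ hρT hρ₀ hρ₃ hL.split₂ hD0 (hdgDHd ν) hL.ta₂ hLH.tb₂H
  have hK : 0 ≤ (B₀ + bH.κ * B₃) * t * c :=
    mul_nonneg (mul_nonneg (add_nonneg hB₀ (mul_nonneg bH.κ_nonneg hB₃)) ht) hc
  have hc1 : (B₀ + bH.κ * B₃) * t * c ≤ θD := by linarith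
  refine ⟨hA.mono fun a b => kernel_le'' hK hc1 hδK (hG.dnn a b), ((hA.add hB).congr fun μ => ?_).mono fun a b => ?_⟩
  · simp only [LinearMap.add_apply, LinearMap.comp_apply, map_add]
  · calc (B₀ + bH.κ * B₃) * t * c * Real.exp (-(ρ * g.dist a b)) + (B₀ + bH.κ * B₃) * t * c * Real.exp (-(ρ * g.dist a b))
        = 2 * ((B₀ + bH.κ * B₃) * t * c) * Real.exp (-(ρ * g.dist a b)) := by ring
      _ ≤ θD * Real.exp (-(δK * g.dist a b)) := kernel_le'' (mul_nonneg (by norm_num) hK) hθD hδK (hG.dnn a b)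

/-! ## §4 The schema `StepDir` of rows 20–21 from Theorem 3.3 for G₀ and the letters -/

omit [Fintype Y] [Fintype P] in
/-- ★★ **THE DIRECTION-INDEXED PERTURBATION-STEP SCHEMA OF ROWS 20–21 FROM THEOREM 3.3 FOR G₀ AND THE (3.131) ∕ (3.137) LETTERS** — the shape
n06-d's binder `hstepC` (conjunct 1) consumes: the eight LEFT-form field families of `StepDir` are PROVED from `Thm33G0Dir` (its `h43L`, `e1d`,
`h43d`; rows 18's Theorem 3.10 after `B9Thm312WholeFromThm310.thm33G0Dir_of_conv3107`), `Letters313H` (`pYDH`, `pXDv`), `Letters313DM` (`dgDHd`),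
the two new G₀-probe members `Thm33G0DirX`, the letters `Letters3131` ∕ `Letters3131H` of Δ′_π, Δ⁽²⁾_π, the row sum (2.61) at rate σ and the member
facts `Facts347` (p. 398's transfer, for the Φ^X_β member), by `stepDd_of_letters3131`, `probeStep_of_split` (E = Φ^Y_β∇_U, Φ^X_β∇_{U,ν}) and
`probeStepX_of_split`; the two RIGHT-form families `tDd`, `tDd1` (Δ′_πG₀∇\*_{U,μ} out of the input class — the derivative *"applied … on the
right"*, a right split of T) are HYPOTHESES here.  Constants: θ_D ≧ 2(B₀ + κ_H·B₃)·t·c; θ_H ≧ the three β-families `hθH1`–`hθH3` FOR ALL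
β ∈ [0,1) (LOCATED REMARK U2: β-uniform, as the registered schema's single θ_H forces); rates: 0 ≦ δ_K, δ_K + αδ ≦ ρ ≦ δ_T, ρ + σ ≦ min(δ₀, δ₃).
In print t = O(1)·Mα₀, hence θ_D, θ_H = O(1)·Mα₀ (*"each operator Δ′_π provides the small factor α₀"*, p. 422).
[cite: Balaban1985BackgroundPropagators, Thm 3.12 p.423 + (3.130)–(3.131) pp.421–422 + (3.137)–(3.138) p.423 + Thm 3.3 p.399 + (3.42)–(3.45) pp.397–398 + (3.39)–(3.40) p.397 + p.398 (remarks after (3.47)); Balaban1984PropagatorsII, (2.54) p.233 + Lemma 2.1 (2.60)–(2.61) p.234] -/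
theorem stepDir_of_letters3131 (hG : GeoOK g) {𝔬 : Ops g B X Y Z W} {𝔭 : HolderProbes g B X Y PX PY}
    {Dd Dds : B.Cfg → P → Module.End ℝ (X → ℝ)} {bHX : ℝ → BlockNorm (toB6 g R₀ H₀) (X → ℝ)}
    {bH : BlockNorm (toB6 g R₀ H₀) (W → ℝ)} {Ta Ta₂ : B.Cfg → Module.End ℝ (X → ℝ)} {Tb Tb₂ : B.Cfg → (X → ℝ) →ₗ[ℝ] (W → ℝ)}
    {U : B.Cfg} {d : ℕ} {δ α L₀ : ℝ} (hF : Facts347 g R₀ H₀ d δ α L₀)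
    {B₀ B₃ t δ₀ δ₃ δT ρ σ c θD θH δK : ℝ} {Bh Bi : ℝ → ℝ} {Bi2 : ℝ → ℝ → ℝ} {BhD Bx Bq Bx0 BdX : ℝ → ℝ}
    (hrow : RowSum (toB6 g R₀ H₀) σ c) (hc : 0 ≤ c) (hB₀ : 0 ≤ B₀) (hB₃ : 0 ≤ B₃) (ht : 0 ≤ t)
    (hBh : ∀ β : ℝ, 0 ≤ β → β < 1 → 0 ≤ Bh β) (hBhD : ∀ β : ℝ, 0 ≤ β → β < 1 → 0 ≤ BhD β)
    (hBx : ∀ β : ℝ, 0 ≤ β → β < 1 → 0 ≤ Bx β) (hBx0 : ∀ β : ℝ, 0 ≤ β → β < 1 → 0 ≤ Bx0 β)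
    (hBdX : ∀ β : ℝ, 0 ≤ β → β < 1 → 0 ≤ BdX β)
    (hρT : ρ ≤ δT) (hρ₀ : ρ + σ ≤ δ₀) (hρ₃ : ρ + σ ≤ δ₃) (hαδ : 0 ≤ α * δ) (hδK0 : 0 ≤ δK) (hδK : δK + α * δ ≤ ρ)
    (hθD : 2 * ((B₀ + bH.κ * B₃) * t * c) ≤ θD)
    (hθH1 : ∀ β : ℝ, 0 ≤ β → β < 1 → 2 * ((Bh β + bH.κ * BhD β) * t * c) ≤ θH)
    (hθH2 : ∀ β : ℝ, 0 ≤ β → β < 1 → 2 * ((Bh β + bH.κ * BdX β) * t * c) ≤ θH)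
    (hθH3 : ∀ β : ℝ, 0 ≤ β → β < 1 → 2 * ((Bx0 β + Bx β) * t * c * L₀) ≤ θH)
    (h33 : Thm33G0Dir 𝔬 𝔭 Dd Dds R₀ H₀ bHX B₀ Bh Bi Bi2 δ₀ U) (hLH3 : Letters313H 𝔬 𝔭 R₀ H₀ hG.lenle bH BhD Bx δ₃ U)
    (hDM : Letters313DM 𝔬 𝔭 Dd R₀ H₀ hG B₃ Bq δ₃ bH U) (hX : Thm33G0DirX 𝔬 𝔭 Dd R₀ H₀ hG.lenle bH Bx0 BdX δ₀ δ₃ U)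
    (hL : Letters3131 𝔬 Ta Ta₂ Tb Tb₂ R₀ H₀ hG.lenle t δT U) (hLH : Letters3131H 𝔬 Tb Tb₂ R₀ H₀ hG.lenle bH t δT U)
    (htDd : ∀ (μ : P) (ε : ℝ), 0 < ε → HasMaj (bHX ε) (cNormR R₀ H₀ 𝔬.blk hG.lenle 1) (𝔬.Tpi U ∘ₗ (𝔬.G0 U ∘ₗ Dds U μ))
      (fun a b => θH * Real.exp (-(δK * g.dist a b))))
    (htDd1 : ∀ (μ : P) (ε : ℝ), 0 < ε → HasMaj (bHX ε) (cNormR R₀ H₀ 𝔬.blk hG.lenle 1)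
      ((𝔬.Tpi U + 𝔬.T2 U) ∘ₗ (𝔬.G0 U ∘ₗ Dds U μ)) (fun a b => θH * Real.exp (-(δK * g.dist a b)))) :
    StepDir 𝔬 𝔭 Dd Dds R₀ H₀ bHX hG.lenle θD θH δK U := by
  have hρ : 0 ≤ ρ := by linarith
  have hαρ : α * δ ≤ ρ := by linarith
  have hδKρ : δK ≤ ρ := by linarith
  have hδKρ' : δK ≤ ρ - α * δ := by linarith
  have hL₀ : 0 ≤ L₀ := le_trans (le_trans zero_le_one hF.one_le_L) hF.L_le
  -- the probe members: E = Φ^Y_β∇_U and E = Φ^X_β∇_{U,ν}, for T = Δ′_π (one split) and T = Δ′_π + Δ⁽²⁾_π (two splits, added)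
  have probe2 : ∀ {F : Type} [AddCommGroup F] [Module ℝ F] {bout : BlockNorm (toB6 g R₀ H₀) F} {EG : (X → ℝ) →ₗ[ℝ] F} {a aD : ℝ},
      0 ≤ a → 0 ≤ aD → 2 * ((a + bH.κ * aD) * t * c) ≤ θH →
      HasMaj (cNormR R₀ H₀ 𝔬.blk hG.lenle 0) bout EG (fun a' b => a * Real.exp (-(δ₀ * g.dist a' b))) →
      HasMaj bH bout (EG ∘ₗ 𝔬.Dv U) (fun a' b => aD * Real.exp (-(δ₃ * g.dist a' b))) →
      HasMaj (cNormR R₀ H₀ 𝔬.blk hG.lenle (-2)) bout (EG ∘ₗ 𝔬.Tpi U) (fun a' b => θH * Real.exp (-(δK * g.dist a' b))) ∧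
        HasMaj (cNormR R₀ H₀ 𝔬.blk hG.lenle (-2)) bout (EG ∘ₗ (𝔬.Tpi U + 𝔬.T2 U))
          (fun a' b => θH * Real.exp (-(δK * g.dist a' b))) := by
    intro F _ _ bout EG a aD ha haD hθ hE hED
    have hA := probeStep_of_split hG hrow ha haD ht hρ hρT hρ₀ hρ₃ hL.split hE hED hL.ta hLH.tbH
    have hB := probeStep_of_split hG hrow ha haD ht hρ hρT hρ₀ hρ₃ hL.split₂ hE hED hL.ta₂ hLH.tb₂H
    have hK : 0 ≤ (a + bH.κ * aD) * t * c := mul_nonneg (mul_nonneg (add_nonneg ha (mul_nonneg bH.κ_nonneg haD)) ht) hc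
    have hc1 : (a + bH.κ * aD) * t * c ≤ θH := by linarith
    refine ⟨hA.mono fun a' b => kernel_le'' hK hc1 hδKρ (hG.dnn a' b), ((hA.add hB).congr fun μ => ?_).mono fun a' b => ?_⟩
    · simp only [LinearMap.add_apply, LinearMap.comp_apply, map_add]
    · calc (a + bH.κ * aD) * t * c * Real.exp (-(ρ * g.dist a' b)) + (a + bH.κ * aD) * t * c * Real.exp (-(ρ * g.dist a' b))
          = 2 * ((a + bH.κ * aD) * t * c) * Real.exp (-(ρ * g.dist a' b)) := by ring
        _ ≤ θH * Real.exp (-(δK * g.dist a' b)) := kernel_le'' (mul_nonneg (by norm_num) hK) hθ hδKρ (hG.dnn a' b)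
  -- the Φ^X_β member of the step itself, for T = Δ′_π and T = Δ′_π + Δ⁽²⁾_π
  have probeX2 : ∀ β : ℝ, 0 ≤ β → β < 1 →
      HasMaj (cNormR R₀ H₀ 𝔬.blk hG.lenle (-1)) (cNormR R₀ H₀ 𝔭.blkPX hG.lenle (β - 1)) ((𝔭.ΦX U β ∘ₗ 𝔬.G0 U) ∘ₗ 𝔬.Tpi U)
          (fun a' b => θH * Real.exp (-(δK * g.dist a' b))) ∧
        HasMaj (cNormR R₀ H₀ 𝔬.blk hG.lenle (-1)) (cNormR R₀ H₀ 𝔭.blkPX hG.lenle (β - 1))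
          ((𝔭.ΦX U β ∘ₗ 𝔬.G0 U) ∘ₗ (𝔬.Tpi U + 𝔬.T2 U)) (fun a' b => θH * Real.exp (-(δK * g.dist a' b))) := by
    intro β hβ0 hβ1
    have hA := probeStepX_of_split hG hF hrow hc (hBx0 β hβ0 hβ1) (hBx β hβ0 hβ1) ht hαρ hαδ hρT hρ₀ hρ₃ hL.split
      (hX.pX0 β hβ0 hβ1) (hLH3.pXDv β hβ0 hβ1) hL.ta hL.tb
    have hB := probeStepX_of_split hG hF hrow hc (hBx0 β hβ0 hβ1) (hBx β hβ0 hβ1) ht hαρ hαδ hρT hρ₀ hρ₃ hL.split₂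
      (hX.pX0 β hβ0 hβ1) (hLH3.pXDv β hβ0 hβ1) hL.ta₂ hL.tb₂
    have hK : 0 ≤ (Bx0 β + Bx β) * t * c * L₀ :=
      mul_nonneg (mul_nonneg (mul_nonneg (add_nonneg (hBx0 β hβ0 hβ1) (hBx β hβ0 hβ1)) ht) hc) hL₀
    have hc1 : (Bx0 β + Bx β) * t * c * L₀ ≤ θH := by linarith [hθH3 β hβ0 hβ1]
    refine ⟨hA.mono fun a' b => kernel_le'' hK hc1 hδKρ' (hG.dnn a' b), ((hA.add hB).congr fun μ => ?_).mono fun a' b => ?_⟩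
    · simp only [LinearMap.add_apply, LinearMap.comp_apply, map_add]
    · calc (Bx0 β + Bx β) * t * c * L₀ * Real.exp (-((ρ - α * δ) * g.dist a' b)) +
            (Bx0 β + Bx β) * t * c * L₀ * Real.exp (-((ρ - α * δ) * g.dist a' b))
          = 2 * ((Bx0 β + Bx β) * t * c * L₀) * Real.exp (-((ρ - α * δ) * g.dist a' b)) := by ring
        _ ≤ θH * Real.exp (-(δK * g.dist a' b)) := kernel_le'' (mul_nonneg (by norm_num) hK) (hθH3 β hβ0 hβ1) hδKρ' (hG.dnn a' b)
  -- assembling the ten field families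
  refine
    { pY := fun β hβ0 hβ1 => (probe2 (hBh β hβ0 hβ1) (hBhD β hβ0 hβ1) (hθH1 β hβ0 hβ1)
        (hasMaj_probe_cNormR_of_hom hG (hBh β hβ0 hβ1) (h33.h43L β hβ0 hβ1)) (hLH3.pYDH β hβ0 hβ1)).1
      pY1 := fun β hβ0 hβ1 => (probe2 (hBh β hβ0 hβ1) (hBhD β hβ0 hβ1) (hθH1 β hβ0 hβ1)
        (hasMaj_probe_cNormR_of_hom hG (hBh β hβ0 hβ1) (h33.h43L β hβ0 hβ1)) (hLH3.pYDH β hβ0 hβ1)).2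
      pX := fun β hβ0 hβ1 => (probeX2 β hβ0 hβ1).1
      pX1 := fun β hβ0 hβ1 => (probeX2 β hβ0 hβ1).2
      sDd := fun ν => (stepDd_of_letters3131 hG hrow hc hB₀ hB₃ ht hρ hρT hρ₀ hρ₃ hθD hδKρ h33.e1d hDM.dgDHd hL hLH ν).1
      sDd1 := fun ν => (stepDd_of_letters3131 hG hrow hc hB₀ hB₃ ht hρ hρT hρ₀ hρ₃ hθD hδKρ h33.e1d hDM.dgDHd hL hLH ν).2
      pXd := fun ν β hβ0 hβ1 => (probe2 (hBh β hβ0 hβ1) (hBdX β hβ0 hβ1) (hθH2 β hβ0 hβ1)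
        (hasMaj_probe_cNormR_of_hom hG (hBh β hβ0 hβ1) (h33.h43d ν β hβ0 hβ1)) (hX.pXdDH ν β hβ0 hβ1)).1
      pXd1 := fun ν β hβ0 hβ1 => (probe2 (hBh β hβ0 hβ1) (hBdX β hβ0 hβ1) (hθH2 β hβ0 hβ1)
        (hasMaj_probe_cNormR_of_hom hG (hBh β hβ0 hβ1) (h33.h43d ν β hβ0 hβ1)) (hX.pXdDH ν β hβ0 hβ1)).2
      tDd := htDd
      tDd1 := htDd1 }

end

end Literature.MathematicalPhysics.QuantumFieldTheory.Balaban1983to89.B9Thm312WholeStepDirFrom3131
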